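import Summits.BirchSwinnertonDyer.Rank1Residual.X11b.Three.CornerShapeGammaSerre
import HarnessLib

/-!
# Class X11b at `p = 3`, the non-surjective CORNER: the `3`-part of the Tamagawa product is carried
# by the SPLIT multiplicative primes (and a γ-carrier over `2`) — team N8/O2 = cell `b2b-bsdres`,
# sub-target S14♮ (seat x11b3-p6)

HONEST FRAMING (verbatim, cell `b2b-bsdres`, run/shared/lean/b2b/bsd-rank1-residual/): the goal of
the cell is to DELETE the COMBINATION-SHAPED residual classes of the Birch–Swinnerton-Dyer formula for
ALL analytic-rank `≤ 1` elliptic curves over `ℚ` — assembled STRICTLY from published theorems — so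
that the rank-`≤ 1` remainder becomes exactly the CONSTRUCTION-SHAPED classes, which are TYPED, NOT
attempted. This is not "finishing BSD". Team N8/O2 (X11b at `3`; §I O2 OPEN, X11 ∧ r = 1 ∧ p = 3
CONSTRUCTION-SHAPED). Research route; nothing booked; NO label changes. THEOREMS ONLY: no
definition, no named fact, no `sorry`.

## What this file proves

On the non-surjective corner of X11b@3 (`ClassX11b W 3 ∧ ¬ Surj W 3`) the two divisibility
conditions in the Tamagawa atom `3 ∣ ∏ c_ℓ ⟺ (T2α) ∨ (T2β) ∨ (T2γ)`
(`three_dvd_tamagawaProduct_iff_shapes`) are AUTOMATIC: `3 ∣ ord_3 Δ_min` and `¬ Ram W 3`, i.e.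
`3 ∣ ord_ℓ Δ_min` at EVERY multiplicative `ℓ ≠ 3` (`ClassX11b.dvd_and_not_ram_of_not_surj`,
Silverman *ATAEC* V.6.1 / the Tate curve). Hence:

* `Three.shapeAlpha_iff_split_of_not_surj` — on the corner, (T2α)@3 ⟺ `E` is SPLIT multiplicative
  at `3`;
* `Three.shapeBeta_iff_exists_split_of_not_surj` — on the corner, (T2β)@3 ⟺ `E` has SOME split
  multiplicative prime `ℓ ≠ 3`;
* **`Three.three_dvd_tamagawaProduct_iff_of_not_surj`** — on the corner,
  `3 ∣ ∏ c_ℓ(E) ⟺ (∃ ℓ, E split multiplicative at ℓ) ∨ (T2γ)@3`;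
* `Three.three_dvd_tamagawaProduct_iff_of_not_surj_of_serre` — the same with the γ-carrier confined
  to the place over `2` (S14, CONDITIONAL on Serre 1972 §5.6 =
  `Serre1972.inertiaOrder_dvd_card_range_galoisRepTorsion`);
* `Three.exists_split_of_not_surj_of_three_dvd_of_not_shapeGamma` — the (C2) reading: a corner pair
  with `3 ∣ ∏ c_ℓ` and no γ-carrier has a split multiplicative prime.

Kernel form of `cells/x11b3/CORNER-CENSUS.md` §2.2 (EVIDENCE there, 296 corner class-pairs, two
engines): `3 ∣ ∏c` on 208 = all 129 split(3) pairs (`c₃ = v₃(Δ) ≥ 3`) + 79 non-split(3) pairs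
where a split multiplicative `ℓ ≠ 3` carries; `3 ∤ ∏c` on the 88 others (all non-split at `3`, no
split multiplicative prime); no γ-carrier anywhere (IV/IV*: 0 of 484 additive places). HONEST
VALUE: anatomy / typing aid for the corner inputs (C1)/(C2) of CLASS RECORD v4.2 (R6-1); no TRUE-OPEN
cell closed; nothing booked. Axioms: `propext`, `Classical.choice`, `Quot.sound`.

## References

* [SilvermanATAEC1994] J. H. Silverman, *Advanced Topics in the Arithmetic of Elliptic Curves*,
  GTM 151: IV.9.4 Steps 2, 5, 8 and Table 4.1 (Tamagawa numbers); V.6 Prop. 6.1.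
* [Serre1972] J.-P. Serre, Invent. Math. 15 (1972), §2.4 Prop. 15, §5.6.
* [MartinWatkins2006] P. Martin, M. Watkins, IMRN 2006, §3.2.
* Cell files: `cells/x11b3/CORNER-CENSUS.md` §2.2–§2.3′, `OWNERS.md` (S14 line, R6-1).
-/

noncomputable section

open scoped Classical NumberField

open WeierstrassCurve NumberField IsDedekindDomain Literature.NumberTheory.EllipticCurves
  Rat.HeightOneSpectrum Literature.NumberTheory.DiophantineGeometry
  Literature.NumberTheory.EllipticCurves.Rank1Residual

namespace Summit.BirchSwinnertonDyer.Rank1Residual.X11b.Three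

variable (W : WeierstrassCurve ℚ) [W.IsElliptic] [W.IsGloballyMinimal]

/-- **On the corner, (T2α)@3 ⟺ split multiplicative at `3`**: the divisibility `3 ∣ ord_3 Δ_min`
in `ShapeAlpha` is automatic (`ClassX11b.dvd_and_not_ram_of_not_surj`).
[cite: SilvermanATAEC1994, V.6 Prop. 6.1 (p. 410)] -/
theorem shapeAlpha_iff_split_of_not_surj [Fact (Nat.Prime 3)] (hX : ClassX11b W 3) (hns : ¬ Surj W 3) :
    ShapeAlpha W ↔ W.HasSplitMultiplicativeReductionAtPrime 3 :=
  ⟨fun h ↦ h.1, fun h ↦ ⟨h, (ClassX11b.dvd_and_not_ram_of_not_surj W 3 hX hns).1⟩⟩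

/-- **On the corner, (T2β)@3 ⟺ some split multiplicative prime `ℓ ≠ 3`**: the divisibility
`3 ∣ ord_ℓ Δ_min` in `ShapeBeta` is automatic, since the corner has no (ram) prime
(`ClassX11b.dvd_and_not_ram_of_not_surj`: every multiplicative `ℓ ≠ 3` has `3 ∣ ord_ℓ Δ_min`).
[cite: SilvermanATAEC1994, V.6 Prop. 6.1 (p. 410)] [cite: Serre1972, §2.4 Prop. 15] -/
theorem shapeBeta_iff_exists_split_of_not_surj [Fact (Nat.Prime 3)] (hX : ClassX11b W 3)
    (hns : ¬ Surj W 3) :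
    ShapeBeta W ↔
      ∃ ℓ : ℕ, ∃ _ : Fact ℓ.Prime, ℓ ≠ 3 ∧ W.HasSplitMultiplicativeReductionAtPrime ℓ := by
  refine ⟨fun ⟨ℓ, hℓ, h3, hs, _⟩ ↦ ⟨ℓ, hℓ, h3, hs⟩, fun ⟨ℓ, hℓ, h3, hs⟩ ↦ ⟨ℓ, hℓ, h3, hs, ?_⟩⟩
  by_contra hnd
  exact (ClassX11b.dvd_and_not_ram_of_not_surj W 3 hX hns).2
    ⟨ℓ, hℓ, h3, hs.hasMultiplicativeReductionAtPrime, hnd⟩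

/-- **THE `3`-PART OF THE TAMAGAWA PRODUCT ON THE CORNER**: for a corner pair of X11b@3,
`3 ∣ ∏_ℓ c_ℓ(E)` iff `E` has a SPLIT multiplicative prime (at `3`: `c₃ = ord_3 Δ_min`, a multiple of
`3`; at `ℓ ≠ 3`: `c_ℓ = ord_ℓ Δ_min`, a multiple of `3` because the corner has no (ram) prime) or a
(T2γ)@3 carrier (a place of type `IV`/`IV*` with `c = 3`). UNCONDITIONAL.
[cite: SilvermanATAEC1994, IV.9.4 Steps 2, 5, 8 and Table 4.1; V.6 Prop. 6.1] -/
theorem three_dvd_tamagawaProduct_iff_of_not_surj [Fact (Nat.Prime 3)] (hX : ClassX11b W 3)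
    (hns : ¬ Surj W 3) :
    3 ∣ W.tamagawaProduct ↔
      (∃ ℓ : ℕ, ∃ _ : Fact ℓ.Prime, W.HasSplitMultiplicativeReductionAtPrime ℓ) ∨ ShapeGamma W := by
  rw [three_dvd_tamagawaProduct_iff_shapes W, shapeAlpha_iff_split_of_not_surj W hX hns,
    shapeBeta_iff_exists_split_of_not_surj W hX hns]
  constructor
  · rintro (h3 | ⟨ℓ, hℓ, -, hs⟩ | hγ)
    · exact Or.inl ⟨3, inferInstance, h3⟩
    · exact Or.inl ⟨ℓ, hℓ, hs⟩
    · exact Or.inr hγ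
  · rintro (⟨ℓ, hℓ, hs⟩ | hγ)
    · by_cases h3 : ℓ = 3
      · subst h3
        exact Or.inl (by convert hs)
      · exact Or.inr (Or.inl ⟨ℓ, hℓ, h3, hs⟩)
    · exact Or.inr (Or.inr hγ)

/-- **(C2) reading: a corner pair with `3 ∣ ∏ c_ℓ` and no γ-carrier has a split multiplicative
prime** (at `3` or elsewhere). UNCONDITIONAL. [cite: SilvermanATAEC1994, IV.9.4 Table 4.1; V.6 Prop. 6.1] -/
theorem exists_split_of_not_surj_of_three_dvd_of_not_shapeGamma [Fact (Nat.Prime 3)]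
    (hX : ClassX11b W 3) (hns : ¬ Surj W 3) (h3 : 3 ∣ W.tamagawaProduct) (hγ : ¬ ShapeGamma W) :
    ∃ ℓ : ℕ, ∃ _ : Fact ℓ.Prime, W.HasSplitMultiplicativeReductionAtPrime ℓ :=
  ((three_dvd_tamagawaProduct_iff_of_not_surj W hX hns).mp h3).resolve_right hγ

/-- **(C1) reading: a corner pair with NO split multiplicative prime and no γ-carrier has
`3 ∤ ∏ c_ℓ`.** UNCONDITIONAL. [cite: SilvermanATAEC1994, IV.9.4 Table 4.1; V.6 Prop. 6.1] -/
theorem not_three_dvd_tamagawaProduct_of_not_surj_of_forall_not_split [Fact (Nat.Prime 3)]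
    (hX : ClassX11b W 3) (hns : ¬ Surj W 3)
    (hsplit : ∀ (ℓ : ℕ) [Fact ℓ.Prime], ¬ W.HasSplitMultiplicativeReductionAtPrime ℓ)
    (hγ : ¬ ShapeGamma W) : ¬ 3 ∣ W.tamagawaProduct := fun h3 ↦ by
  obtain ⟨ℓ, hℓ, hs⟩ := exists_split_of_not_surj_of_three_dvd_of_not_shapeGamma W hX hns h3 hγ
  exact hsplit ℓ hs

/-- **The `3`-part of the Tamagawa product on the corner, with the named fact**: `3 ∣ ∏ c_ℓ(E)` iff
`E` has a split multiplicative prime or a place OVER `2` of type `IV`/`IV*` with `c₂ = 3` (S14: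
on the corner a γ-carrier lies over `2`; CONDITIONAL on Serre 1972 §5.6 =
`Serre1972.inertiaOrder_dvd_card_range_galoisRepTorsion`). [cite: MartinWatkins2006, §3.2]
[cite: Serre1972, §5.6 (p. 312)] [cite: SilvermanATAEC1994, IV.9.4 Table 4.1; V.6 Prop. 6.1] -/
theorem three_dvd_tamagawaProduct_iff_of_not_surj_of_serre [Fact (Nat.Prime 3)]
    (hS : Serre1972.inertiaOrder_dvd_card_range_galoisRepTorsion)
    (hX : ClassX11b W 3) (hns : ¬ Surj W 3) :
    3 ∣ W.tamagawaProduct ↔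
      (∃ ℓ : ℕ, ∃ _ : Fact ℓ.Prime, W.HasSplitMultiplicativeReductionAtPrime ℓ) ∨
        ∃ v : HeightOneSpectrum (𝓞 ℚ), (primesEquiv v : ℕ) = 2 ∧
          (W.kodairaSymbolAt v = .IV ∨ W.kodairaSymbolAt v = .IVstar) ∧ W.tamagawaNumberAt v = 3 := by
  rw [three_dvd_tamagawaProduct_iff_of_not_surj W hX hns]
  refine or_congr_right ⟨fun hγ ↦ shapeGamma_over_two_of_not_surj_of_serre W hS hX hns hγ, ?_⟩
  rintro ⟨v, -, hk, hc⟩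
  exact ⟨v, hk, hc⟩

end Summit.BirchSwinnertonDyer.Rank1Residual.X11b.Three
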